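import Literature.Probability.LatticeModels.ManeuverChain
import Literature.Probability.LatticeModels.KilledWalkHubFactorisation
import HarnessLib

/-!
# Free exit probabilities versus killed hitting probabilities (line `symplectic-fermion-anchor`,
crux `SAWLoopFugacityFlow.AvoidanceLimit`, stmt-CriticalPhenomena-10649)

Two comparison lemmas transferring a free-walk maneuver estimate (vertex formalism: `harmExt`, the
harmonic extension for the FREE nearest-neighbour Laplacian of `ℤ²`, `HarmonicExtension.lean`) to
the EDGE-killed walk along a subgraph `Gr` of `ℤ²` in a finite region `Λ`
(`hitProb Gr Λ A = killedHarmExt Gr (Λ ∖ A) 𝟙_A`, `KilledWalkHubFactorisation.lean`), as used in the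
shield lemma (corrected form of Chelkak 2016, Lemma 2.14) of the line's hub factorisation:

* `harmExt_hit_le_hitProb` — if `S ⊆ Λ ∩ W` misses `A` and every one of the four lattice edges at a
  site of `S` is a `Gr`-edge, then the free probability to leave `S ∩ W` through `A`,
  `harmExt (S ∩ W) 𝟙_A`, is at most `hitProb Gr Λ A` everywhere: the killed hitting probability is
  killed-harmonic on `Λ ∖ A ⊇ S`, hence FREE-harmonic on `S` (all four edges present), and dominates
  the data `𝟙_A` everywhere; comparison principle for the free Laplacian on the finite set `S ∩ W`.
* `mul_hitProb_le_of_superharmonic` — optional stopping: for `h ≥ 0` killed-superharmonic on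
  `Λ ∖ A` with `h ≥ m ≥ 0` on `A`, `m · hitProb Gr Λ A ≤ h` everywhere (comparison principle for the
  killed walk on `Λ ∖ A`; off it `hitProb = 𝟙_A`).

Everything is proved from the maximum principles of `LatticeLaplacian.lean` and
`KilledWalkLaplacian.lean`. No definitions. Source: D. Chelkak, *Robust discrete complex analysis:
a toolbox*, Ann. Probab. 44 (2016), §2.3 and §3.1 [Chelkak2016]; G. F. Lawler, V. Limic,
*Random Walk: A Modern Introduction* (2010), §6.1 [LawlerLimic2010].
-/

noncomputable section

open scoped BigOperators Classical
open Finset Literature.Probability.LatticeModels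

namespace Summit.CriticalPhenomena.SAWScalingLimit.Theorems.AvoidanceLimit.Anchor

/-- The indicator of `A` is dominated by the killed hitting probability of `A` everywhere:
`𝟙_A w ≤ hitProb Gr Λ A w` (`= 1` on `A`, `≥ 0` elsewhere). [folklore] -/
theorem indicator_le_hitProb {Gr : SimpleGraph (Site 2)} {Λ : Set (Site 2)} (A : Set (Site 2))
    (hΛ : Λ.Finite) (w : Site 2) : (if w ∈ A then (1 : ℝ) else 0) ≤ hitProb Gr Λ A w := by
  by_cases hw : w ∈ A
  · rw [if_pos hw, hitProb_of_mem hw]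
  · rw [if_neg hw]; exact hitProb_nonneg hΛ w

/-- **The free first-exit-into-`A` probability is below the killed hitting probability of `A`.**
Let `Λ, W` be finite, `S ⊆ Λ`, `S ⊆ W`, `S ∩ A = ∅`, and suppose that at every site `v ∈ S` all four
lattice edges `v ~ v + e` are `Gr`-edges. Then for every `x`,
`harmExt (S ∩ W) 𝟙_A x ≤ hitProb Gr Λ A x`. Proof: off `S ∩ W` the left side is the data `𝟙_A x`,
which is `≤ hitProb` (`= 1` on `A`, `≥ 0` elsewhere). On `S ∩ W`: `hitProb Gr Λ A` is
killed-harmonic on `Λ ∖ A ⊇ S ∩ W`, and since all four edges at a site of `S` are `Gr`-edges the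
killed average there is the plain lattice average, so `hitProb` is lattice-harmonic on `S ∩ W`
(`isKilledHarmonicOn_iff_isLatticeHarmonicOn`); the comparison principle for the free Laplacian on
the finite set `S ∩ W` (`harmExt_le_of_superharmonic`) with the boundary inequality
`𝟙_A ≤ hitProb` concludes. [cite: Chelkak2016, §2.3] -/
theorem harmExt_hit_le_hitProb :
    ∀ (Gr : SimpleGraph (Site 2)) (S A Λ W : Set (Site 2)), Λ.Finite → W.Finite → S ⊆ Λ → S ⊆ W →
      Disjoint S A → (∀ v ∈ S, ∀ e : SRW.Dir 2, Gr.Adj v (v + SRW.stepVec e)) →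
      ∀ x : Site 2, harmExt (S ∩ W) (fun w => if w ∈ A then (1 : ℝ) else 0) x ≤ hitProb Gr Λ A x := by
  intro Gr S A Λ W hΛ hW hSΛ _ hSA hadj x
  have hUfin : (S ∩ W).Finite := hW.subset fun _ hz => hz.2
  by_cases hx : x ∈ S ∩ W
  · -- `hitProb` is killed-harmonic on `Λ ∖ A ⊇ S ∩ W`, hence lattice-harmonic on `S ∩ W`
    have hsub : S ∩ W ⊆ Λ \ A := fun z hz =>
      ⟨hSΛ hz.1, fun hzA => Set.disjoint_left.1 hSA hz.1 hzA⟩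
    have hkh : IsKilledHarmonicOn Gr (hitProb Gr Λ A) (S ∩ W) := (hitProb_harmonicOn hΛ).mono hsub
    have hlh : IsLatticeHarmonicOn (hitProb Gr Λ A) (S ∩ W) :=
      (isKilledHarmonicOn_iff_isLatticeHarmonicOn (fun v hv e => hadj v hv.1 e)).1 hkh
    exact harmExt_le_of_superharmonic hUfin hlh.superharmonicOn
      (fun w _ => indicator_le_hitProb A hΛ w) hx
  · rw [harmExt_of_not_mem hUfin _ hx]
    exact indicator_le_hitProb A hΛ x

/-- **Optional stopping: `m · P[hit A] ≤ h`.** Let `Λ` be finite, `0 ≤ m`, `h ≥ 0` everywhere,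
`h` superharmonic for the edge-killed walk `Gr` on `Λ ∖ A`, and `m ≤ h` on `A`. Then
`m · hitProb Gr Λ A x ≤ h x` for every `x`. Proof: off `Λ ∖ A`, `hitProb` is the indicator of `A`,
so the claim is `m ≤ h` on `A` and `0 ≤ h` off `Λ ∪ A`; on `Λ ∖ A`, `m · hitProb` is killed-harmonic
and `h` killed-superharmonic, and the inequality on the outer boundary (which lies off `Λ ∖ A`) is
the previous case: comparison principle (`le_of_killedSub_killedSuper_of_boundary`).
[cite: LawlerLimic2010, §6.1] -/
theorem mul_hitProb_le_of_superharmonic :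
    ∀ (Gr : SimpleGraph (Site 2)) (Λ A : Set (Site 2)) (h : Site 2 → ℝ) (m : ℝ), Λ.Finite → 0 ≤ m →
      (∀ w, 0 ≤ h w) → IsKilledSuperharmonicOn Gr h (Λ \ A) → (∀ w ∈ A, m ≤ h w) →
      ∀ x : Site 2, m * hitProb Gr Λ A x ≤ h x := by
  intro Gr Λ A h m hΛ _ hh0 hsuper hA x
  have hSfin : (Λ \ A).Finite := hΛ.subset fun _ hz => hz.1
  -- off `Λ ∖ A`: `hitProb = 𝟙_A`
  have hoff : ∀ z, z ∉ Λ \ A → m * hitProb Gr Λ A z ≤ h z := by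
    intro z hz
    rw [hitProb_of_not_mem hz]
    by_cases hzA : z ∈ A
    · rw [if_pos hzA, mul_one]; exact hA z hzA
    · rw [if_neg hzA, mul_zero]; exact hh0 z
  by_cases hx : x ∈ Λ \ A
  · have h1 : IsKilledHarmonicOn Gr (fun z => m * hitProb Gr Λ A z) (Λ \ A) :=
      (hitProb_harmonicOn hΛ).const_mul m
    exact le_of_killedSub_killedSuper_of_boundary hSfin h1.subharmonicOn hsuper
      (fun z hz => hoff z hz.1) x hx
  · exact hoff x hx

end Summit.CriticalPhenomena.SAWScalingLimit.Theorems.AvoidanceLimit.Anchor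

end
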